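import Mathlib
import HarnessLib
import Literature.Probability.Percolation.Percolation
import Literature.Probability.Percolation.ColourSwitching
import Literature.Probability.Percolation.AnchoredProfileExploration
import Literature.Probability.Percolation.AnchoredProfileVanishing
import Literature.Probability.LatticeModels.LatticeGraph
import Literature.Probability.LatticeModels.ThermodynamicLimit
import Summits.CriticalPhenomena.PercolationContinuityZ3.Theorems.PercTreeValueTetrahedronLogConvexityCertDefs

/-!
# Stopping property of the truncated two-seed exploration (stub `stub_stopping`)

Crux `TetrahedronLogConvexity` (stmt-CriticalPhenomena-7801), line `Sketch` (certificate form).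
The objects are those of `PercTreeValueTetrahedronLogConvexityCertDefs.lean`: the open lattice
graph `latOpen ω = ℤ³ ⊓ openGraph ω`, the truncated merge layer
`NR r R ω = min(⌈d_ω(0,a_r)/2⌉, R)` and the examined edges `explored r R ω` (all lattice edges of
the window `Λ(R+r+1)` incident to a vertex at open distance `< NR` from `0` or from `a_r`).

Main result `stub_stopping`: `explored r R` is a stopping set in the sense of
`Literature.Probability.Percolation.IsStoppingSet` (configurations agreeing on the examined edges
have the same examined edges), and such configurations have the same `NR`.

Proof (combinatorics of breadth-first layers, no probability):
* window lemma `stopping_mem_explored`: a lattice edge at a vertex of open distance `< NR ≤ R` from a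
  seed lies in `Λ(R+r+1)` (a lattice walk of length `ℓ` moves every coordinate by at most `ℓ`,
  tree lemmas `CerfDembinVanishing.abs_sub_le_length`, `CerfDembin.mem_box_succ_of_adj`), hence it
  is examined;
* walk transfer `stopping_edist_le_length` / capped ball agreement `stopping_ball`: by induction
  along a geodesic, the open-distance balls of radius `k ≤ NR(ω)` around each seed agree for two
  configurations agreeing on `explored r R ω`;
* midpoint lemma `stopping_edist_le_two_mul_iff`: `d(0,a_r) ≤ 2n` iff some vertex is within `n` of
  both seeds, so the defining predicate of `NR` agrees for `n ≤ NR(ω)` and `Nat.find` gives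
  `NR(ω') = NR(ω)`; the examined edges then agree by the strict ball agreement at radius `NR`.
-/

noncomputable section

open MeasureTheory
open Literature.Probability.Percolation Literature.Probability.LatticeModels

namespace Summit.CriticalPhenomena.PercolationContinuityZ3.Theorems.TetrahedronLogConvexity.Cert

/-! ### Generic graph-distance lemmas -/

/-- Walk transfer: if every `L`-edge leaving a vertex at (both) distances `< m` from `u` is a
`K`-edge, then along any `L`-walk to `u` of length `≤ m` the `K`-distance from `u` is at most the
length of the walk (induction along the walk). [folklore] -/
theorem stopping_edist_le_length {V : Type*} {L K : SimpleGraph V} {m : ℕ} :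
    ∀ {x u : V} (p : L.Walk x u),
      (∀ z y, L.edist u z < m → K.edist u z < m → L.Adj z y → K.Adj z y) →
      p.length ≤ m → K.edist u x ≤ p.length := by
  intro x u p
  induction p with
  | nil => intro _ _; simp
  | @cons a b c h q ih =>
    intro hstep hlen
    rw [SimpleGraph.Walk.length_cons] at hlen ⊢
    have hqm : q.length < m := by omega
    have hK : K.edist c b ≤ q.length := ih hstep (by omega)
    have hL : L.edist c b ≤ q.length := by
      rw [SimpleGraph.edist_comm]
      exact SimpleGraph.edist_le q
    have hqm' : (q.length : ℕ∞) < m := by exact_mod_cast hqm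
    have hadj : K.Adj b a := hstep b a (hL.trans_lt hqm') (hK.trans_lt hqm') h.symm
    calc K.edist c a ≤ K.edist c b + K.edist b a := SimpleGraph.edist_triangle
      _ = K.edist c b + 1 := by rw [SimpleGraph.edist_eq_one_iff_adj.2 hadj]
      _ ≤ (q.length : ℕ∞) + 1 := add_le_add hK le_rfl
      _ = ((q.length + 1 : ℕ) : ℕ∞) := by push_cast; rfl

/-- Ball transfer: under the same one-step hypothesis, `L`-balls of radius `k ≤ m` around `u` are
contained in the corresponding `K`-balls. [folklore] -/
theorem stopping_edist_le_of_le {V : Type*} {L K : SimpleGraph V} {u : V} {m k : ℕ}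
    (hstep : ∀ z y, L.edist u z < m → K.edist u z < m → L.Adj z y → K.Adj z y) (hk : k ≤ m)
    {x : V} (hx : L.edist u x ≤ k) : K.edist u x ≤ k := by
  have hne : L.edist u x ≠ ⊤ := ne_top_of_le_ne_top (ENat.coe_ne_top k) hx
  obtain ⟨p, hp⟩ := SimpleGraph.exists_walk_of_edist_ne_top hne
  have hpk : p.length ≤ k := by
    rw [← hp] at hx
    exact_mod_cast hx
  have h := stopping_edist_le_length p.reverse hstep
    (by rw [SimpleGraph.Walk.length_reverse]; exact hpk.trans hk)
  rw [SimpleGraph.Walk.length_reverse] at h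
  exact h.trans (by exact_mod_cast hpk)

/-- Midpoint lemma: `d(u,v) ≤ 2n` iff some vertex is within distance `n` of both `u` and `v`
(split a geodesic at its `n`-th vertex; conversely the triangle inequality). [folklore] -/
theorem stopping_edist_le_two_mul_iff {V : Type*} {H : SimpleGraph V} {u v : V} {n : ℕ} :
    H.edist u v ≤ 2 * (n : ℕ∞) ↔ ∃ x, H.edist u x ≤ n ∧ H.edist v x ≤ n := by
  have h2 : (2 * (n : ℕ∞)) = ((2 * n : ℕ) : ℕ∞) := by push_cast; rfl
  constructor
  · intro h
    rw [h2] at h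
    have hne : H.edist u v ≠ ⊤ := ne_top_of_le_ne_top (ENat.coe_ne_top _) h
    obtain ⟨p, hp⟩ := SimpleGraph.exists_walk_of_edist_ne_top hne
    have hlen : p.length ≤ 2 * n := by
      rw [← hp] at h
      exact_mod_cast h
    refine ⟨p.getVert n, ?_, ?_⟩
    · calc H.edist u (p.getVert n) ≤ ((p.take n).length : ℕ∞) := SimpleGraph.edist_le _
        _ ≤ n := by
          rw [SimpleGraph.Walk.take_length]
          exact_mod_cast min_le_left _ _
    · rw [SimpleGraph.edist_comm]
      calc H.edist (p.getVert n) v ≤ ((p.drop n).length : ℕ∞) := SimpleGraph.edist_le _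
        _ ≤ n := by
          rw [SimpleGraph.Walk.drop_length]
          exact_mod_cast (by omega : p.length - n ≤ n)
  · rintro ⟨x, hux, hvx⟩
    rw [SimpleGraph.edist_comm] at hvx
    calc H.edist u v ≤ H.edist u x + H.edist x v := SimpleGraph.edist_triangle
      _ ≤ (n : ℕ∞) + n := add_le_add hux hvx
      _ = 2 * (n : ℕ∞) := (two_mul _).symm

/-! ### Lattice geometry of the exploration -/

/-- A vertex at `H`-distance `< m` from `u` (`H` a subgraph of `ℤ³`) is within sup-distance `< m`
of `u` (a lattice walk of length `ℓ` moves every coordinate by at most `ℓ`,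
`CerfDembinVanishing.abs_sub_le_length`). [folklore] -/
theorem stopping_abs_sub_lt_of_edist_lt {H : SimpleGraph (Site 3)} (hH : H ≤ zdGraph 3)
    {u x : Site 3} {m : ℕ} (h : H.edist u x < m) (i : Fin 3) : |x i - u i| < m := by
  obtain ⟨p, hp⟩ := SimpleGraph.exists_walk_of_edist_ne_top (ne_top_of_lt h)
  have h1 := CerfDembinVanishing.abs_sub_le_length hH p i
  have h2 : p.length < m := by
    rw [← hp] at h
    exact_mod_cast h
  calc |x i - u i| ≤ p.length := h1
    _ < m := by exact_mod_cast h2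

/-- The coordinates of `a_r` are bounded by `r`. [folklore] -/
theorem stopping_abs_vA_le (r : ℕ) (i : Fin 3) : |vA r i| ≤ r := by
  fin_cases i <;> simp [vA]

/-- Adjacency in the open lattice graph: a lattice edge that is open. [folklore] -/
theorem stopping_latOpen_adj {ω : BondConfig (Site 3)} {x y : Site 3} :
    (latOpen ω).Adj x y ↔ (zdGraph 3).Adj x y ∧ s(x, y) ∈ ω := by
  unfold latOpen
  rw [SimpleGraph.inf_adj, openGraph_adj]
  exact ⟨fun h => ⟨h.1, h.2.1⟩, fun h => ⟨h.1, h.2, h.1.ne⟩⟩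

/-- **Window lemma.** Every lattice edge at a vertex of open distance `< NR` from `0` or from
`a_r` is an examined edge (in particular it lies in the finite window `Λ(R+r+1)`, because
`NR ≤ R` and lattice steps move each coordinate by at most one). [folklore] -/
theorem stopping_mem_explored {r R : ℕ} {ω : BondConfig (Site 3)} {x y : Site 3}
    (hxy : (zdGraph 3).Adj x y)
    (hx : (latOpen ω).edist 0 x < NR r R ω ∨ (latOpen ω).edist (vA r) x < NR r R ω) :
    s(x, y) ∈ explored r R ω := by
  classical
  have hNR := NR_le r R ω
  have hxi : ∀ i, -((R : ℤ) + r) ≤ x i ∧ x i ≤ (R : ℤ) + r := by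
    intro i
    rcases hx with h | h
    · have h1 := stopping_abs_sub_lt_of_edist_lt (latOpen_le_zdGraph ω) h i
      simp only [Pi.zero_apply, sub_zero] at h1
      rw [abs_lt] at h1
      omega
    · have h1 := stopping_abs_sub_lt_of_edist_lt (latOpen_le_zdGraph ω) h i
      have h2 := stopping_abs_vA_le r i
      rw [abs_lt] at h1
      rw [abs_le] at h2
      omega
  have hxbox : x ∈ box 3 (R + r) := by
    rw [mem_box]
    intro i
    have := hxi i
    push_cast
    omega
  -- a lattice step out of `Λ(R+r)` lands in `Λ(R+r+1)` (tree lemma)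
  have hybox : y ∈ box 3 (R + r + 1) := CerfDembin.mem_box_succ_of_adj hxy hxbox
  have hxbox' : x ∈ box 3 (R + r + 1) := box_mono 3 (Nat.le_succ _) hxbox
  unfold explored edgeWindow
  rw [Finset.mem_filter, Finset.mem_filter, Finset.mk_mem_sym2_iff, SimpleGraph.mem_edgeSet]
  exact ⟨⟨⟨hxbox', hybox⟩, hxy⟩, x, Sym2.mem_mk_left x y, hx⟩

/-- One-step transfer: configurations agreeing on the examined edges of `ω` have the same open
lattice edges at every vertex of open distance `< NR(ω)` from a seed. [folklore] -/
theorem stopping_adj_transfer {r R : ℕ} {ω ω' : BondConfig (Site 3)}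
    (hag : ∀ e ∈ explored r R ω, (e ∈ ω ↔ e ∈ ω')) {x y : Site 3}
    (hx : (latOpen ω).edist 0 x < NR r R ω ∨ (latOpen ω).edist (vA r) x < NR r R ω) :
    (latOpen ω).Adj x y ↔ (latOpen ω').Adj x y := by
  rw [stopping_latOpen_adj, stopping_latOpen_adj]
  constructor
  · rintro ⟨hl, he⟩
    exact ⟨hl, (hag _ (stopping_mem_explored hl hx)).1 he⟩
  · rintro ⟨hl, he⟩
    exact ⟨hl, (hag _ (stopping_mem_explored hl hx)).2 he⟩

/-- **Capped ball agreement.** Configurations agreeing on the examined edges of `ω` have the same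
open-distance balls of every radius `k ≤ NR(ω)` around each seed (`s = 0` or `s = a_r`, encoded
by `hs`). [folklore] -/
theorem stopping_ball {r R : ℕ} {ω ω' : BondConfig (Site 3)}
    (hag : ∀ e ∈ explored r R ω, (e ∈ ω ↔ e ∈ ω')) {s : Site 3}
    (hs : ∀ z, (latOpen ω).edist s z < NR r R ω →
      ((latOpen ω).edist 0 z < NR r R ω ∨ (latOpen ω).edist (vA r) z < NR r R ω))
    {k : ℕ} (hk : k ≤ NR r R ω) (x : Site 3) :
    (latOpen ω).edist s x ≤ k ↔ (latOpen ω').edist s x ≤ k :=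
  ⟨stopping_edist_le_of_le (fun z _ h1 _ h3 => (stopping_adj_transfer hag (hs z h1)).1 h3) hk,
    stopping_edist_le_of_le (fun z _ _ h2 h3 => (stopping_adj_transfer hag (hs z h2)).2 h3) hk⟩

/-- Strict form of the capped ball agreement at radius `NR(ω)`. [folklore] -/
theorem stopping_ball_lt {r R : ℕ} {ω ω' : BondConfig (Site 3)}
    (hag : ∀ e ∈ explored r R ω, (e ∈ ω ↔ e ∈ ω')) {s : Site 3}
    (hs : ∀ z, (latOpen ω).edist s z < NR r R ω →
      ((latOpen ω).edist 0 z < NR r R ω ∨ (latOpen ω).edist (vA r) z < NR r R ω))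
    (x : Site 3) :
    (latOpen ω).edist s x < NR r R ω ↔ (latOpen ω').edist s x < NR r R ω := by
  rcases Nat.eq_zero_or_eq_succ_pred (NR r R ω) with h | h
  · rw [h]
    simp
  · rw [h, Nat.cast_succ, ENat.lt_coe_add_one_iff, ENat.lt_coe_add_one_iff]
    exact stopping_ball hag hs (by omega) x

/-! ### The merge layer and the examined edges are determined by the examined edges -/

/-- The defining property of `NR`: `d(0,a_r) ≤ 2·NR` or `NR = R`. [folklore] -/
theorem stopping_NR_spec (r R : ℕ) (ω : BondConfig (Site 3)) :
    (latOpen ω).edist 0 (vA r) ≤ 2 * (NR r R ω : ℕ∞) ∨ NR r R ω = R := by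
  classical
  unfold NR
  exact Nat.find_spec (⟨R, Or.inr rfl⟩ : ∃ n : ℕ, (latOpen ω).edist 0 (vA r) ≤ 2 * (n : ℕ∞) ∨ n = R)

/-- Minimality of `NR`. [folklore] -/
theorem stopping_NR_min (r R : ℕ) (ω : BondConfig (Site 3)) {n : ℕ} (hn : n < NR r R ω) :
    ¬ ((latOpen ω).edist 0 (vA r) ≤ 2 * (n : ℕ∞) ∨ n = R) := by
  classical
  unfold NR at hn
  exact Nat.find_min _ hn

/-- Characterisation of `NR` by its defining property and minimality. [folklore] -/
theorem stopping_NR_eq_of {r R : ℕ} {ω : BondConfig (Site 3)} {m : ℕ}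
    (hm : (latOpen ω).edist 0 (vA r) ≤ 2 * (m : ℕ∞) ∨ m = R)
    (hmin : ∀ n < m, ¬ ((latOpen ω).edist 0 (vA r) ≤ 2 * (n : ℕ∞) ∨ n = R)) :
    NR r R ω = m := by
  classical
  unfold NR
  rw [Nat.find_eq_iff]
  exact ⟨hm, hmin⟩

/-- **The merge layer is determined by the examined edges**: configurations agreeing on
`explored r R ω` have the same `NR` (midpoint lemma + capped ball agreement). [folklore] -/
theorem stopping_NR_eq {r R : ℕ} {ω ω' : BondConfig (Site 3)}
    (hag : ∀ e ∈ explored r R ω, (e ∈ ω ↔ e ∈ ω')) : NR r R ω' = NR r R ω := by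
  have key : ∀ n ≤ NR r R ω, (((latOpen ω').edist 0 (vA r) ≤ 2 * (n : ℕ∞) ∨ n = R) ↔
      ((latOpen ω).edist 0 (vA r) ≤ 2 * (n : ℕ∞) ∨ n = R)) := by
    intro n hn
    refine or_congr ?_ Iff.rfl
    rw [stopping_edist_le_two_mul_iff, stopping_edist_le_two_mul_iff]
    exact exists_congr fun x => and_congr (stopping_ball hag (fun _ h => Or.inl h) hn x).symm
      (stopping_ball hag (fun _ h => Or.inr h) hn x).symm
  exact stopping_NR_eq_of ((key _ le_rfl).2 (stopping_NR_spec r R ω))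
    (fun n hn h => stopping_NR_min r R ω hn ((key n hn.le).1 h))

/-- **The examined edges are determined by the examined edges** (stopping property):
configurations agreeing on `explored r R ω` have the same examined edges. [folklore] -/
theorem stopping_explored_eq {r R : ℕ} {ω ω' : BondConfig (Site 3)}
    (hag : ∀ e ∈ explored r R ω, (e ∈ ω ↔ e ∈ ω')) : explored r R ω' = explored r R ω := by
  classical
  have hNR := stopping_NR_eq hag
  ext e
  simp only [explored, Finset.mem_filter, hNR]
  refine and_congr_right fun _ => exists_congr fun x => and_congr_right fun _ => ?_
  exact or_congr (stopping_ball_lt hag (fun _ h => Or.inl h) x).symm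
    (stopping_ball_lt hag (fun _ h => Or.inr h) x).symm

/-- **Stopping property of the truncated two-seed exploration** (stub `stub_stopping` of the
certificate line): the examined edges `explored r R` form a stopping set — configurations agreeing
on the examined edges have the same examined edges — and they determine the truncated merge layer
`NR r R`. Pure combinatorics of breadth-first layers: by induction on the layer, the open-distance
balls of radius `≤ NR` around both seeds agree, because every edge used to grow them is an
examined edge. [folklore] -/
theorem stub_stopping : ∀ r R : ℕ,
    IsStoppingSet (explored r R) ∧
    ∀ ω ω' : BondConfig (Site 3), (∀ e ∈ explored r R ω, e ∈ ω ↔ e ∈ ω') → NR r R ω' = NR r R ω := by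
  intro r R
  refine ⟨?_, ?_⟩
  · intro ω ω' hag
    exact stopping_explored_eq hag
  · intro ω ω' hag
    exact stopping_NR_eq hag

end Summit.CriticalPhenomena.PercolationContinuityZ3.Theorems.TetrahedronLogConvexity.Cert

end
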